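import Summits.HodgeConjecture.HodgeConjecture.Theorems.R90S6EllipticOrbitalDisplacementU2   -- ★ A1-H (p01): `O_γ(1_{K₀tᵏK₀}) = ν(K₀)·#{x self-dual : d(x,γx) = 2k}`, type-0 bookkeeping
import Summits.HodgeConjecture.HodgeConjecture.Theorems.R90S6TreeDisplacementSphereCount     -- ★ W8-f (p10): displacement shells in closed form (`_of_odd` ∕ `_of_even`)
import Summits.HodgeConjecture.HodgeConjecture.Theorems.R90S6TreeFixDataFirstShell            -- ★ GF1 (K2Liu-p14): first shell + fixed set = degree·(fixed of the other type) + 1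
import HarnessLib

/-!
# R90 · S6 «Ch. 14.1–14.5 stable TF» — CARD LL1-COUNT: THE LABESSE–LANGLANDS `κ`-COUNT ON THE `(q+1)`-REGULAR TREE — `S₀(k) − S₁(k) = (−1)^{k+1} q^{k−1} (N₀ − N₁)`,
# `N₀ − N₁ = (q+1)(F₁ − F₀)`, AND THE ORBITAL DIFFERENCE `O_δ(φ′_k) − O_{δ′}(φ′_k) = ν(K₀)·(S₀(δ,k) − S₁(δ,k))` (`Theorems/R90S6RankOneKappaCount.lean`; DAG r24 row E1.3.7.1)

Cell `hodgecm-mathlib`, crux H413 (`stmt-HodgeConjecture-24833`), route of record `HCCMUnconditional`; programme R90-TF, section S6 (base `R90-C14`),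
seat R90-C14-p02 (g2); S6 dealer R90-C14-plan (g2) CARD LL1-COUNT = (LL1.2) + (LL1.3) (R90 bus 2026-09-05T02:30:29Z; census K2E3-p28 (g4) 02:25:22Z, whose engine
`R90S6TreeTypeSwapU2` will discharge the transport hypothesis `hswap` below — decoupled, no wait).  Lane `--supports stmt-HodgeConjecture-24833 --as helper`; THEOREMS
ONLY; letters = ★ W8-f ∕ ★ GF1 (generic locally finite tree `G`, automorphism `α : G ≃g G` with finite non-empty fixed set, type function `c : V → Fin 2`) and ★ A1-H
(`K`, `σ`, `ϖ`, `U₂ = unitaryGroupOfForm σ H₂`, `K₀ = unitaryInt σ H₂`, `t`, `X₂ = latticeTree σ ϖ H₂`, `latticeTreeIso`, the measure tower `ρ ν hC hρ`, VERBATIM).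

NOTATION (all counts are written out as `Set.ncard`s; no definition): `S_i(k) = #{x | d(x, αx) = 2k ∧ c x = i}` (displacement shell of type `i`), `N_i = S_i(1)` (first shell),
`F_i = #{x ∈ Fix α | c x = i}`.
* §1 (LL1.3) GENERIC REGULAR TREES (every moved vertex of degree `q + 1`):
  **`ncard_displaced_type_sub_eq_of_regular`**: `S₀(k) − S₁(k) = (−1)^{k+1}·q^{k−1}·(N₀ − N₁)` in `ℤ` (`k ≥ 1`; ★ W8-f `_of_odd`∕`_of_even` at `q₀ = q₁ = q`: odd `k = 2m+1`:
  `S_i = q^{2m} N_i`; even `k = 2m+2`: `S_i = q^{2m+1} N_{1−i}`); **`setOf_displaced_zero_type_eq`**: `{d(x,αx) = 0 ∧ c x = i} = {αx = x ∧ c x = i}` (`k = 0`: `S_i(0) = F_i`);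
  **`ncard_displaced_two_type_sub_eq`**: `N₀ − N₁ = (q+1)·(F₁ − F₀)` when every FIXED vertex has degree `q + 1` (★ GF1 `ncard_displaced_two_inter_type_add_card_fixed_eq`:
  `N_i + #F = (q+1)·F_j + 1`); together `S₀(k) − S₁(k) = (−1)^k (q+1) q^{k−1} (F₀ − F₁)` — the Labesse–Langlands unstable count.
* §2 (LL1.2) **`orbitalIntegral_doubleCosetShell_sub_eq_two`**: on `U(2)_w ≅ U(1,1)` (★ A1-H letters, both `δ` and `δ′` with compact centralisers and their own measure binders),
  under the TRANSPORT HYPOTHESIS `hswap : #{x self-dual : d(x, δ′x) = 2k} = #{x | d(x, δx) = 2k ∧ c x = 1}` (the type swap by the similitude `diag(ϖ,1)`; K2E3-p28's engine),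
  `O_δ(φ′_k) − O_{δ′}(φ′_k) = ν(K₀)·(S₀(δ,k) − S₁(δ,k))`.
HONEST LABEL: tree ∕ measure bookkeeping over ★ carriers; `hswap`, the X₂ valency and the self-dual transitivity `hA` are BINDERS; proves no printed global statement, discharges
no citation; count-neutral until E1.3.7.1 ∕ typ1's (E1) sheet consume it.  HC_CM is proved only modulo the 7 printed citations (2 remaining named inputs: hLiu418 =
stmt-HodgeConjecture-24832, h413 = stmt-HodgeConjecture-24833) until rung 0 closes; REL ≠ ★ ≠ BUILT.

## References
* [LabesseLanglands1979] J.-P. Labesse, R. P. Langlands, *L-indistinguishability for SL(2)*, Canad. J. Math. 31 (1979), §§2–3 (the unstable orbital integral on the tree).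
* [Rogawski1990] J. D. Rogawski, *Automorphic Representations of Unitary Groups in Three Variables*, Ann. of Math. Stud. 123 (1990), §4.9 pp. 54–55, §4.11 pp. 59–60.
* [Serre1980Trees] J.-P. Serre, *Trees* (1980), I.2.3 Ex. 2, I.6.1, I.6.4 Prop. 24.
* [Kottwitz1980] R. Kottwitz, *Orbital integrals on GL₃*, Amer. J. Math. 102 (1980), §3 (counting on the building).
-/

set_option autoImplicit false
-- the mandated namespace repeats the single-problem summit's segment (`HodgeConjecture.HodgeConjecture`)
set_option linter.dupNamespace false

noncomputable section

open MeasureTheory Measure Topology Set Function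
open scoped ENNReal NNReal Pointwise ValuativeRel Matrix MatrixGroups
open MulAction SimpleGraph Matrix ValuativeRel
open Literature.MeasureTheory.Group Literature.NumberTheory.Automorphic
open Literature.NumberTheory.Automorphic.HermitianLatticeTree
open Literature.Combinatorics.SimpleGraph

namespace Summit.HodgeConjecture.HodgeConjecture.R90.S6

/-! ## §1 (LL1.3) The `κ`-count on a regular tree -/

section Tree

variable {V : Type*} {G : SimpleGraph V}

/-- **(LL1.3) THE TYPE DIFFERENCE OF THE DISPLACEMENT SHELLS ON A REGULAR TREE**: on a locally finite tree with an automorphism `α` of finite non-empty fixed set, a type function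
`c` (adjacent vertices of different types) and every MOVED vertex of degree `q + 1` (`U(2)_w`: `q = q_v`), for `k ≥ 1`:
**`S₀(k) − S₁(k) = (−1)^{k+1} · q^{k−1} · (N₀ − N₁)`** (`S_i(k) = #{x | d(x,αx) = 2k ∧ c x = i}`, `N_i = S_i(1)`) — ★ W8-f at `q₀ = q₁ = q`: odd levels keep the type of the first
shell (`S_i(2m+1) = q^{2m} N_i`), even levels swap it (`S_i(2m+2) = q^{2m+1} N_{1−i}`). [cite: LabesseLanglands1979, §§2–3] [cite: Serre1980Trees, I.2.3, I.6.4 Prop. 24] -/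
theorem ncard_displaced_type_sub_eq_of_regular [G.LocallyFinite] (hT : G.IsTree) (α : G ≃g G) {u : V} (hu : α u = u) (hfin : {v | α v = v}.Finite)
    (c : V → Fin 2) (hc : ∀ v w, G.Adj v w → c v ≠ c w) (q : ℕ) (hdeg : ∀ v, α v ≠ v → G.degree v = q + 1) {k : ℕ} (hk : 1 ≤ k) :
    (({x | G.dist x (α x) = 2 * k ∧ c x = 0}.ncard : ℤ) - {x | G.dist x (α x) = 2 * k ∧ c x = 1}.ncard) =
      (-1) ^ (k + 1) * (q : ℤ) ^ (k - 1) * (({x | G.dist x (α x) = 2 ∧ c x = 0}.ncard : ℤ) - {x | G.dist x (α x) = 2 ∧ c x = 1}.ncard) := by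
  have hdeg' : ∀ v, α v ≠ v → G.degree v = (fun _ : Fin 2 => q) (c v) + 1 := fun v hv => hdeg v hv
  have h01 : (0 : Fin 2) ≠ 1 := by decide
  rcases Nat.even_or_odd' k with ⟨m, rfl | rfl⟩
  · -- `k = 2m`, `m = m' + 1`: the even level swaps the type of the first shell
    obtain ⟨m', rfl⟩ := Nat.exists_eq_add_of_le' (show 1 ≤ m by omega)
    have e : 2 * (2 * (m' + 1)) = 2 * (2 * m' + 2) := by ring
    rw [e, ncard_displaced_inter_type_eq_of_even hT α hu hfin c hc (fun _ : Fin 2 => q) hdeg' h01 m',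
      ncard_displaced_inter_type_eq_of_even hT α hu hfin c hc (fun _ : Fin 2 => q) hdeg' h01.symm m',
      show 2 * (m' + 1) - 1 = 2 * m' + 1 by omega, Odd.neg_one_pow ⟨m' + 1, by ring⟩]
    push_cast
    ring
  · -- `k = 2m + 1`: the odd level keeps the type
    rw [ncard_displaced_inter_type_eq_of_odd hT α hu hfin c hc (fun _ : Fin 2 => q) hdeg' h01 m,
      ncard_displaced_inter_type_eq_of_odd hT α hu hfin c hc (fun _ : Fin 2 => q) hdeg' h01.symm m,
      show 2 * m + 1 - 1 = 2 * m by omega, Even.neg_one_pow ⟨m + 1, by ring⟩]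
    push_cast
    ring

/-- **(LL1.3, `k = 0`)**: the displacement shell of radius `0` is the fixed set — `{x | d(x, αx) = 2·0 ∧ c x = i} = {x | αx = x ∧ c x = i}` (a tree is connected, so `d = 0 ↔ =`);
hence `S_i(0) = F_i` and `S₀(0) − S₁(0) = F₀ − F₁`. [cite: Serre1980Trees, I.6.1] -/
theorem setOf_displaced_zero_type_eq (hT : G.IsTree) (α : G ≃g G) (c : V → Fin 2) (i : Fin 2) :
    {x | G.dist x (α x) = 2 * 0 ∧ c x = i} = {x | α x = x ∧ c x = i} := by
  ext x
  simp only [Set.mem_setOf_eq, mul_zero, hT.connected.dist_eq_zero_iff]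
  exact ⟨fun h => ⟨h.1.symm, h.2⟩, fun h => ⟨h.1.symm, h.2⟩⟩

/-- **(LL1.3, fixed-point currency) `N₀ − N₁ = (q+1)·(F₁ − F₀)`**: when every FIXED vertex has degree `q + 1` (`F_i = #{x ∈ Fix α | c x = i}`), the first shells satisfy
`N_i + #Fix = (q+1)·F_j + 1` (★ GF1 `ncard_displaced_two_inter_type_add_card_fixed_eq`: each fixed edge has one endpoint of each type), whence the difference.  With
`ncard_displaced_type_sub_eq_of_regular`: `S₀(k) − S₁(k) = (−1)^k (q+1) q^{k−1} (F₀ − F₁)` (`k ≥ 1`). [cite: LabesseLanglands1979, §§2–3] [cite: Serre1980Trees, I.6.1] -/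
theorem ncard_displaced_two_type_sub_eq [DecidableEq V] [G.LocallyFinite] (hT : G.IsTree) (α : G ≃g G) {u : V} (hu : α u = u) (hfin : {v | α v = v}.Finite)
    (c : V → Fin 2) (hc : ∀ v w, G.Adj v w → c v ≠ c w) (q : ℕ) (hdegF : ∀ y, α y = y → G.degree y = q + 1) :
    (({x | G.dist x (α x) = 2 ∧ c x = 0}.ncard : ℤ) - {x | G.dist x (α x) = 2 ∧ c x = 1}.ncard) =
      ((q : ℤ) + 1) * (((hfin.toFinset.filter (fun y => c y = 1)).card : ℤ) - (hfin.toFinset.filter (fun y => c y = 0)).card) := by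
  have h01 : (0 : Fin 2) ≠ 1 := by decide
  have h0 := ncard_displaced_two_inter_type_add_card_fixed_eq hT α hu hfin c hc h01 (fun _ : Fin 2 => q + 1) (fun y hy => hdegF y hy)
  have h1 := ncard_displaced_two_inter_type_add_card_fixed_eq hT α hu hfin c hc h01.symm (fun _ : Fin 2 => q + 1) (fun y hy => hdegF y hy)
  have h0' : (({x | G.dist x (α x) = 2 ∧ c x = 0}.ncard : ℤ) + hfin.toFinset.card) = ((q : ℤ) + 1) * (hfin.toFinset.filter (fun y => c y = 1)).card + 1 := by
    exact_mod_cast h0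
  have h1' : (({x | G.dist x (α x) = 2 ∧ c x = 1}.ncard : ℤ) + hfin.toFinset.card) = ((q : ℤ) + 1) * (hfin.toFinset.filter (fun y => c y = 0)).card + 1 := by
    exact_mod_cast h1
  linear_combination h0' - h1'

end Tree

/-! ## §2 (LL1.2) The orbital difference on `U(2)_w ≅ U(1,1)` -/

section Two

variable {K : Type} [Field K] [Valued K (WithZero (Multiplicative ℤ))] [ValuativeRel K]
  [(Valued.v : Valuation K (WithZero (Multiplicative ℤ))).Compatible] {σ : K →+* K} {ϖ : K}
  (hd : HermitianLattice.UnramifiedLocalConjDatum σ ϖ)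
  (t : unitaryGroupOfForm σ ((StdForm.antidiagonal 2).over K))
  (ht : (t : GL (Fin 2) K) = zpowDiagGL (CartanUnique.uniformizer_ne_zero hd.vϖ) ![(1 : ℤ), -1])
  (hA : ∀ M : Submodule 𝒪[K] (Fin 2 → K), IsSelfDualLattice σ ((StdForm.antidiagonal 2).over K) M →
    ∃ u : unitaryGroupOfForm σ ((StdForm.antidiagonal 2).over K), latt (((u : GL (Fin 2) K)) : Matrix (Fin 2) (Fin 2) K) = M)
  [LocallyCompactSpace (unitaryGroupOfForm σ ((StdForm.antidiagonal 2).over K))]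
  [SecondCountableTopology (unitaryGroupOfForm σ ((StdForm.antidiagonal 2).over K))]
  [MeasurableSpace (unitaryGroupOfForm σ ((StdForm.antidiagonal 2).over K))] [BorelSpace (unitaryGroupOfForm σ ((StdForm.antidiagonal 2).over K))]
  (ν : Measure (unitaryGroupOfForm σ ((StdForm.antidiagonal 2).over K))) [IsHaarMeasure ν] [ν.IsMulRightInvariant]
  -- the first element `δ`
  (δ : unitaryGroupOfForm σ ((StdForm.antidiagonal 2).over K))
  [MeasurableSpace (unitaryGroupOfForm σ ((StdForm.antidiagonal 2).over K) ⧸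
    Subgroup.centralizer ({δ} : Set (unitaryGroupOfForm σ ((StdForm.antidiagonal 2).over K))))]
  [BorelSpace (unitaryGroupOfForm σ ((StdForm.antidiagonal 2).over K) ⧸
    Subgroup.centralizer ({δ} : Set (unitaryGroupOfForm σ ((StdForm.antidiagonal 2).over K))))]
  [hC : IsClosed ((Subgroup.centralizer ({δ} : Set (unitaryGroupOfForm σ ((StdForm.antidiagonal 2).over K))) :
    Subgroup (unitaryGroupOfForm σ ((StdForm.antidiagonal 2).over K))) : Set (unitaryGroupOfForm σ ((StdForm.antidiagonal 2).over K)))]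
  (ρ : Measure (Subgroup.centralizer ({δ} : Set (unitaryGroupOfForm σ ((StdForm.antidiagonal 2).over K)))))
  [ρ.IsMulLeftInvariant] [IsFiniteMeasureOnCompacts ρ] [ρ.IsOpenPosMeasure] [ρ.IsInvInvariant] [SFinite ρ]
  [CompactSpace (Subgroup.centralizer ({δ} : Set (unitaryGroupOfForm σ ((StdForm.antidiagonal 2).over K))))]
  (hρ : ρ Set.univ = 1)
  -- the second element `δ′`
  (δ' : unitaryGroupOfForm σ ((StdForm.antidiagonal 2).over K))
  [MeasurableSpace (unitaryGroupOfForm σ ((StdForm.antidiagonal 2).over K) ⧸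
    Subgroup.centralizer ({δ'} : Set (unitaryGroupOfForm σ ((StdForm.antidiagonal 2).over K))))]
  [BorelSpace (unitaryGroupOfForm σ ((StdForm.antidiagonal 2).over K) ⧸
    Subgroup.centralizer ({δ'} : Set (unitaryGroupOfForm σ ((StdForm.antidiagonal 2).over K))))]
  [hC' : IsClosed ((Subgroup.centralizer ({δ'} : Set (unitaryGroupOfForm σ ((StdForm.antidiagonal 2).over K))) :
    Subgroup (unitaryGroupOfForm σ ((StdForm.antidiagonal 2).over K))) : Set (unitaryGroupOfForm σ ((StdForm.antidiagonal 2).over K)))]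
  (ρ' : Measure (Subgroup.centralizer ({δ'} : Set (unitaryGroupOfForm σ ((StdForm.antidiagonal 2).over K)))))
  [ρ'.IsMulLeftInvariant] [IsFiniteMeasureOnCompacts ρ'] [ρ'.IsOpenPosMeasure] [ρ'.IsInvInvariant] [SFinite ρ']
  [CompactSpace (Subgroup.centralizer ({δ'} : Set (unitaryGroupOfForm σ ((StdForm.antidiagonal 2).over K))))]
  (hρ' : ρ' Set.univ = 1)

include ht hA hρ hρ'

/-- **(LL1.2) THE `κ`-COMBINATION AS A TYPE DIFFERENCE**: for `δ, δ′ ∈ U₂` with compact centralisers (mass-one `ρ`, `ρ′`), a Haar measure `ν`, the torus generator `t`, a type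
function `c` on `X₂` with `c x = 0 ↔ x` self-dual, `k ∈ ℕ`, finitely many self-dual vertices displaced by `2k` under `δ` and under `δ′`, finitely many type-`1` vertices
displaced by `2k` under `δ`, and the TRANSPORT HYPOTHESIS `hswap : #{x self-dual : d(x, δ′x) = 2k} = #{x | d(x, δx) = 2k ∧ c x = 1}` (the stable-not-conjugate partner `δ′`
sees the `ϖ`-modular shells of `δ`; K2E3-p28's `R90S6TreeTypeSwapU2` discharges it at `δ′ = gδg⁻¹`, `g = diag(ϖ, 1)`):
**`O_δ(φ′_k) − O_{δ′}(φ′_k) = ν(K₀) · (S₀(δ,k) − S₁(δ,k))`** (★ A1-H `orbitalIntegral_doubleCosetShell_eq_mul_ncard_displaced_two` twice).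
[cite: LabesseLanglands1979, §§2–3] [cite: Rogawski1990, §4.11 pp. 59–60] -/
theorem orbitalIntegral_doubleCosetShell_sub_eq_two
    (c : {M : Submodule 𝒪[K] (Fin 2 → K) // IsSpecialLattice σ ϖ ((StdForm.antidiagonal 2).over K) M} → Fin 2)
    (hc0 : ∀ v, c v = 0 ↔ IsSelfDualLattice σ ((StdForm.antidiagonal 2).over K) v.1) (k : ℕ)
    (hfin : {x : {M : Submodule 𝒪[K] (Fin 2 → K) // IsSpecialLattice σ ϖ ((StdForm.antidiagonal 2).over K) M} |
        IsSelfDualLattice σ ((StdForm.antidiagonal 2).over K) x.1 ∧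
          (latticeTree σ ϖ ((StdForm.antidiagonal 2).over K)).dist x (latticeTreeIso σ ϖ ((StdForm.antidiagonal 2).over K) δ x) = 2 * k}.Finite)
    (hfin' : {x : {M : Submodule 𝒪[K] (Fin 2 → K) // IsSpecialLattice σ ϖ ((StdForm.antidiagonal 2).over K) M} |
        IsSelfDualLattice σ ((StdForm.antidiagonal 2).over K) x.1 ∧
          (latticeTree σ ϖ ((StdForm.antidiagonal 2).over K)).dist x (latticeTreeIso σ ϖ ((StdForm.antidiagonal 2).over K) δ' x) = 2 * k}.Finite)
    (hswap : {x : {M : Submodule 𝒪[K] (Fin 2 → K) // IsSpecialLattice σ ϖ ((StdForm.antidiagonal 2).over K) M} |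
        IsSelfDualLattice σ ((StdForm.antidiagonal 2).over K) x.1 ∧
          (latticeTree σ ϖ ((StdForm.antidiagonal 2).over K)).dist x (latticeTreeIso σ ϖ ((StdForm.antidiagonal 2).over K) δ' x) = 2 * k}.ncard =
      {x : {M : Submodule 𝒪[K] (Fin 2 → K) // IsSpecialLattice σ ϖ ((StdForm.antidiagonal 2).over K) M} |
        (latticeTree σ ϖ ((StdForm.antidiagonal 2).over K)).dist x (latticeTreeIso σ ϖ ((StdForm.antidiagonal 2).over K) δ x) = 2 * k ∧ c x = 1}.ncard) :
    orbitalIntegral δ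
        ((DoubleCoset.doubleCoset (t ^ k) (HermitianLattice.unitaryInt σ ((StdForm.antidiagonal 2).over K) : Set _)
            (HermitianLattice.unitaryInt σ ((StdForm.antidiagonal 2).over K))).indicator
          (1 : unitaryGroupOfForm σ ((StdForm.antidiagonal 2).over K) → ℝ))
        (quotientMeasure (Subgroup.centralizer ({δ} : Set (unitaryGroupOfForm σ ((StdForm.antidiagonal 2).over K)))) ρ hC ν) -
      orbitalIntegral δ'
        ((DoubleCoset.doubleCoset (t ^ k) (HermitianLattice.unitaryInt σ ((StdForm.antidiagonal 2).over K) : Set _)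
            (HermitianLattice.unitaryInt σ ((StdForm.antidiagonal 2).over K))).indicator
          (1 : unitaryGroupOfForm σ ((StdForm.antidiagonal 2).over K) → ℝ))
        (quotientMeasure (Subgroup.centralizer ({δ'} : Set (unitaryGroupOfForm σ ((StdForm.antidiagonal 2).over K)))) ρ' hC' ν) =
      (ν (HermitianLattice.unitaryInt σ ((StdForm.antidiagonal 2).over K))).toReal *
        (({x : {M : Submodule 𝒪[K] (Fin 2 → K) // IsSpecialLattice σ ϖ ((StdForm.antidiagonal 2).over K) M} |
            (latticeTree σ ϖ ((StdForm.antidiagonal 2).over K)).dist x (latticeTreeIso σ ϖ ((StdForm.antidiagonal 2).over K) δ x) = 2 * k ∧ c x = 0}.ncard : ℝ) -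
          {x : {M : Submodule 𝒪[K] (Fin 2 → K) // IsSpecialLattice σ ϖ ((StdForm.antidiagonal 2).over K) M} |
            (latticeTree σ ϖ ((StdForm.antidiagonal 2).over K)).dist x (latticeTreeIso σ ϖ ((StdForm.antidiagonal 2).over K) δ x) = 2 * k ∧ c x = 1}.ncard) := by
  rw [orbitalIntegral_doubleCosetShell_eq_mul_ncard_displaced_two hd t ht hA δ ρ ν hρ k hfin,
    orbitalIntegral_doubleCosetShell_eq_mul_ncard_displaced_two hd t ht hA δ' ρ' ν hρ' k hfin', hswap,
    setOf_selfDual_displaced_eq_setOf_displaced_type_zero_two δ c hc0 (2 * k)]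
  ring

end Two

end Summit.HodgeConjecture.HodgeConjecture.R90.S6

end
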